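import Mathlib.FieldTheory.Galois.Basic
import Mathlib.Algebra.Algebra.Rat
import HarnessLib

/-!
# The second twist `√−d` of Monsky's Theorems 5.5 / 5.9 (1) from the genus-field Galois data

Monsky, *Mock Heegner points and congruent numbers*, Math. Z. 204 (1990): the proofs of Thm 5.5 (p. 62,
`D = p₃p₅`, second twist `d = D`) and Thm 5.9 (1) (pp. 63–64, `D = p₅p₇`, second twist `N = p₇`) use a second
quadratic twist `√−d ∈ H(i)` on which `σ = σ_m` and `τ = σ_{1+ϖ}` act trivially while complex conjugation acts
by `−1` ("`m ∈ G_D`", "`m ∈ G_N`"; Lemma 4.1, p. 56: "`i√N ∈ H`"). This file derives these three properties from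
the genus-field Galois data D1 (`GenusFieldGaloisData.galoisData_of_genusRule`): with `√−pq := √p·√−q`,

* `q ≡ 3 (8)` (Monsky (13), `d = pq`): `σ_m`, `τ` fix `√p·√−q` and conjugation negates it;
* `q ≡ 7 (8)` (Monsky (15)⁻, `d = q`): `σ_m`, `τ` fix `√−q` and conjugation negates it.

Inputs: the actions of `σ_m` on `i`, `√p`, `√q = i√−q` (D1), of `τ` on `√p`, `√−q`, and of complex conjugation
on `√p` (real, fixed) and `√−q` (purely imaginary, negated). Everything is fully proved.

## References

* P. Monsky, Mock Heegner points and congruent numbers, Math. Z. 204 (1990) 45–67, Lemma 4.1 (p. 56), Thm 5.5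
  proof (p. 62), Thm 5.9 (1) proof (pp. 63–64). [Monsky1990MockHeegner]
-/

noncomputable section

namespace Literature.NumberTheory.EllipticCurves.Monsky1990

variable {H : Type*} [Field H] [CharZero H]

/-- **The action of `σ_m` on `√−q` from its action on `√q = i·√−q` and on `i`.**
[cite: Monsky1990MockHeegner, p. 62 (σ fixes i)] -/
theorem map_sqrtNegQ_of_map_mul (σ : H ≃ₐ[ℚ] H) {im sqrtNegQ : H} (him : im ^ 2 = -1) (hσi : σ im = im)
    {e : H} (h : σ (im * sqrtNegQ) = e * (im * sqrtNegQ)) : σ sqrtNegQ = e * sqrtNegQ := by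
  have hi0 : im ≠ 0 := by
    intro h0; rw [h0, zero_pow two_ne_zero] at him; exact one_ne_zero (neg_eq_zero.mp him.symm)
  rw [map_mul, hσi] at h
  have : im * (σ sqrtNegQ - e * sqrtNegQ) = 0 := by linear_combination h
  rcases mul_eq_zero.mp this with h0 | h0
  · exact absurd h0 hi0
  · exact sub_eq_zero.mp h0

/-- **The second twist `√−d` on `𝒮⁻`** (Monsky Thms 5.5 / 5.9 (1); Lemma 4.1): from the genus-field data D1 —
`σ_m` fixes `i`, negates `√p`, negates `√q = i√−q` iff `q ≡ 3 (8)`; `τ` fixes `√p`, `√−q`; complex conjugation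
fixes `√p` and negates `√−q` — the element `θ′ := √p·√−q` (`q ≡ 3 (8)`, `θ′² = −pq`) resp. `θ′ := √−q`
(`q ≡ 7 (8)`, `θ′² = −q`) is fixed by `σ_m` and `τ` and negated by conjugation.
[cite: Monsky1990MockHeegner, Lemma 4.1 (p. 56), Thm 5.5 proof (p. 62: "m ∈ G_D"), Thm 5.9 (1) proof (p. 63: "m ∈ G_N")] -/
theorem secondTwist_of_galoisData (σ τ conj : H ≃ₐ[ℚ] H) {p q : ℕ} (hq4 : q % 4 = 3)
    {im sqrtP sqrtNegQ : H} (him : im ^ 2 = -1) (hP : sqrtP ^ 2 = p) (hQ : sqrtNegQ ^ 2 = -q)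
    (hσi : σ im = im) (hσP : σ sqrtP = -sqrtP)
    (hσQ : σ (im * sqrtNegQ) = if q % 8 = 3 then -(im * sqrtNegQ) else im * sqrtNegQ)
    (hτP : τ sqrtP = sqrtP) (hτQ : τ sqrtNegQ = sqrtNegQ) (hcP : conj sqrtP = sqrtP)
    (hcQ : conj sqrtNegQ = -sqrtNegQ) :
    (q % 8 = 3 → (sqrtP * sqrtNegQ) ^ 2 = -((p * q : ℕ) : H) ∧ σ (sqrtP * sqrtNegQ) = sqrtP * sqrtNegQ ∧
      τ (sqrtP * sqrtNegQ) = sqrtP * sqrtNegQ ∧ conj (sqrtP * sqrtNegQ) = -(sqrtP * sqrtNegQ)) ∧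
    (q % 8 = 7 → sqrtNegQ ^ 2 = -(q : H) ∧ σ sqrtNegQ = sqrtNegQ ∧ τ sqrtNegQ = sqrtNegQ ∧
      conj sqrtNegQ = -sqrtNegQ) := by
  constructor
  · intro h3
    rw [if_pos h3] at hσQ
    have hσQ' : σ sqrtNegQ = (-1) * sqrtNegQ :=
      map_sqrtNegQ_of_map_mul σ him hσi (by rw [hσQ, neg_one_mul])
    refine ⟨?_, ?_, ?_, ?_⟩
    · rw [mul_pow, hP, hQ]; push_cast; ring
    · rw [map_mul, hσP, hσQ']; ring
    · rw [map_mul, hτP, hτQ]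
    · rw [map_mul, hcP, hcQ, mul_neg]
  · intro h7
    have h3 : q % 8 ≠ 3 := by omega
    rw [if_neg h3] at hσQ
    have hσQ' : σ sqrtNegQ = 1 * sqrtNegQ :=
      map_sqrtNegQ_of_map_mul σ him hσi (by rw [hσQ, one_mul])
    refine ⟨?_, ?_, hτQ, hcQ⟩
    · rw [hQ]
    · rw [hσQ', one_mul]

end Literature.NumberTheory.EllipticCurves.Monsky1990

end
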